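import Summits.HodgeConjecture.HodgeConjecture.Theorems.MarkmanPartnerTransportK3Sq2KugaSatakeSelfSimilitudeHK
import Summits.HodgeConjecture.HodgeConjecture.Theorems.MarkmanPartnerTransportLowPicardRMCellOneTwoKugaSatake

/-!
# Route MarkmanPartnerTransport · crux `LowPicardRealMultiplication` (stmt-HodgeConjecture-19653) —
# programme «KS-SELF-X», step 5: the crux-#5 Kuga–Satake consumers WITHOUT VARESCO'S RECORD (and without the
# Beauville irreducible-symplectic record): «ORPH-KS», «CELL12-KS», Picard rank one, and crux #5 from four cells

`…K3Sq2KugaSatakeSelfSimilitudeHK` (this seat) PROVED, for a marked smooth projective `K3^{[2]}`-type fourfold,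
the conclusion of Varesco's Cor. 4.6 used by the route: a rational `q`-self-adjoint Hodge self-similitude of
`T(X)` is cycle-induced on `T(X)`, GRANTED `IsKSCorrespondenceAlgebraicHK 2` for `X` and Charles–Markman's `B(X)`.
This file re-derives the route's Kuga–Satake consumers with the named fact
`Varesco2023_transcendentalHodgeSimilitude_algebraic_of_lefschetzStandard` (and `Beauville1983_irreducibleSymplectic_of_k3HilbertType`,
which only fed Varesco's binder) REMOVED from their hypotheses — proofs otherwise VERBATIM those of
`…OrphanKSCore`, `…OrphanKS`, `…LowPicardRMCellOneTwoKugaSatake`: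

* `exists_corrAction_eq_on_bbfTransc_of_kugaSatakeHK` — T1 core, cycle form: `θ = [Z]_*` on `T(X)`, `Z ∈ A⁴(X × X)`;
* `hodgeConjectureFor_of_quadraticEndomorphismField_of_kugaSatakeHK` — «ORPH-KS»: HC⁴(X) for every marked
  projective `K3^{[2]}`-type `X` with `E(X) = ℚ(θ)` real quadratic, GRANTED Kuga–Satake for `X`, modulo
  {Verbitsky–Guan, O'Grady 2008, Charles–Markman 2013} ONLY;
* `hodgeConjectureFor_of_rmGenerator_two_of_kugaSatakeHK`, `cellHC_two_of_kugaSatakeHK` — «CELL12-KS»: the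
  real-quadratic cells `CellHC[ρ, 2]` GRANTED Kuga–Satake;
* `hodgeConjectureFor_of_picard_one_of_kugaSatakeHK` — Picard rank `1`, not isometry-spanned: KS(X) ⇒ HC⁴(X);
* `lowPicardRealMultiplication_of_kugaSatakeHK_of_four_cells` — CRUX #5 BY NAME from Kuga–Satake on the
  quadratic cells and HC⁴ on the cells `(2,3)`, `(2,7)`, `(3,4)`, `(3,5)`.

Net effect: one named fact (Varesco 2023 Cor. 4.6) and one record (Beauville 1983) disappear from every crux-#5
Kuga–Satake consumer. Still CONDITIONAL on the Kuga–Satake statement for the fourfolds concerned (OPEN in print)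
and on {Verbitsky–Guan, O'Grady, Charles–Markman}; credits nothing to HC. THEOREMS ONLY; no sorry, no definition,
no new named fact. Prover seat hodge-nonav-19652-p1 (gen 15), `--supports stmt-HodgeConjecture-19653`.

References: M. Varesco, Math. Z. 305 (2023) Cor. 4.6, Rem. 5.5, Conj. 4.2; F. Charles, E. Markman, Compos. Math.
149 (2013) Thm. 1.1; B. van Geemen, Michigan Math. J. 56 (2008) Lemma 3.2; C. Voisin, *Hodge Theory I* Lemma 11.41.
-/

noncomputable section

set_option linter.dupNamespace false

open scoped TensorProduct
open Module CategoryTheory MonoidalCategory Polynomial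
open Literature.AlgebraicTopology.SingularHomology Literature.Geometry.Kaehler
open Literature.AlgebraicGeometry Literature.AlgebraicGeometry.Motives Literature.AlgebraicGeometry.HodgeTheory
open Literature.AlgebraicGeometry.Hyperkaehler Literature.AlgebraicGeometry.Surfaces
open Summit.HodgeConjecture.HodgeConjecture.Theorems.NikulinTwinTransport
open Summit.HodgeConjecture.HodgeConjecture.Theorems.MarkmanPartnerTransport

namespace Summit.HodgeConjecture.HodgeConjecture.Theorems.MarkmanPartnerTransport.PartnerLattice

/-- `MarkedK3Sq[X, φ, P, z]`: VERBATIM the `let MarkedK3Sq := …` binder of the route declarations of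
MarkmanPartnerTransport (clauses (m1)–(m6)). Local notation only. -/
local notation3 (prettyPrint := false) "MarkedK3Sq[" X ", " φ ", " P ", " z "]" =>
  (((IsIntegralClass P ∧ ∀ Q : complexBetti X (2 * 4), IsIntegralClass Q → ∃ n : ℤ, Q = n • P) ∧
    (∀ c : complexBetti X 2, IsIntegralClass c ↔ ∃ v : K3HilbertIndex → ℤ, φ c = fun i => (v i : ℂ)) ∧
    (∀ a : complexBetti X 2, cupPowTwo a 4 = ((3 : ℂ) * (k3HilbertForm 2 (φ a) (φ a)) ^ 2) • P) ∧
    (IsOfHodgeType 4 X 2 2 0 (LinearEquiv.symm φ z) ∧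
      ∀ τ : complexBetti X 2, IsOfHodgeType 4 X 2 2 0 τ → ∃ t : ℂ, τ = t • LinearEquiv.symm φ z) ∧
    (∀ c : complexBetti X 2, IsOfHodgeType 4 X 2 1 1 c ↔
      (k3HilbertForm 2 (φ c) z = 0 ∧ k3HilbertForm 2 (φ c) (star z) = 0)) ∧
    (k3HilbertForm 2 z z = 0 ∧ 0 < (k3HilbertForm 2 (star z) z).re)))

/-- `SpIso[X, φ]`: VERBATIM the `let SpannedByIsometries := …` binder of the route declarations. Local notation only. -/
local notation3 (prettyPrint := false) "SpIso[" X ", " φ "]" =>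
  (∀ f : complexBetti X 2 →ₗ[ℂ] complexBetti X 2, (∀ y, IsRationalClass y → IsRationalClass (f y)) →
    (∀ (i j : ℕ) y, IsOfHodgeType 4 X 2 i j y → IsOfHodgeType 4 X 2 i j (f y)) →
    (∀ d : complexBetti X 2, d ∈ algebraicClasses X 1 → f d = 0) →
    (∀ y : complexBetti X 2, ∀ d : complexBetti X 2, d ∈ algebraicClasses X 1 →
      k3HilbertForm 2 (φ (f y)) (φ d) = 0) →
    ∃ (k : ℕ) (c : Fin k → ℚ) (g : Fin k → (complexBetti X 2 →ₗ[ℂ] complexBetti X 2)),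
      (∀ i, Function.Bijective (g i) ∧ (∀ y, IsRationalClass y → IsRationalClass (g i y)) ∧
        (∀ (a b : ℕ) y, IsOfHodgeType 4 X 2 a b y → IsOfHodgeType 4 X 2 a b (g i y)) ∧
        (∀ a b, k3HilbertForm 2 (φ (g i a)) (φ (g i b)) = k3HilbertForm 2 (φ a) (φ b))) ∧
      ∀ y : complexBetti X 2, (∀ d : complexBetti X 2, d ∈ algebraicClasses X 1 →
        k3HilbertForm 2 (φ y) (φ d) = 0) → f y = ∑ i : Fin k, ((c i : ℂ) • g i y))

/-- `RMgen[X, φ, z, d]`: VERBATIM the local notation of `…LowPicardRMCells` («RM-GEN» data). Local notation only. -/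
local notation3 (prettyPrint := false) "RMgen[" X ", " φ ", " z ", " d "]" =>
  (∃ θ : complexBetti X 2 →ₗ[ℂ] complexBetti X 2, (∀ y, IsRationalClass y → IsRationalClass (θ y)) ∧
    (∀ (i j : ℕ) y, IsOfHodgeType 4 X 2 i j y → IsOfHodgeType 4 X 2 i j (θ y)) ∧
    (∀ y w : complexBetti X 2, k3HilbertForm 2 (φ (θ y)) (φ w) = k3HilbertForm 2 (φ y) (φ (θ w))) ∧
    ∃ ev : ℂ, θ (LinearEquiv.symm φ z) = ev • LinearEquiv.symm φ z ∧ ev.im = 0 ∧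
      (minpoly ℚ ev).natDegree = d ∧
      (∃ n : ℕ, 3 ≤ n ∧ d * n + Module.finrank ℂ ↥(algebraicClasses X 1) = 23) ∧
      ∀ f : complexBetti X 2 →ₗ[ℂ] complexBetti X 2, (∀ y, IsRationalClass y → IsRationalClass (f y)) →
        (∀ (i j : ℕ) y, IsOfHodgeType 4 X 2 i j y → IsOfHodgeType 4 X 2 i j (f y)) →
        ∃ c : Fin d → ℚ, ∀ y : complexBetti X 2,
          (∀ a : complexBetti X 2, a ∈ algebraicClasses X 1 → k3HilbertForm 2 (φ y) (φ a) = 0) →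
            f y = ∑ i : Fin d, ((c i : ℂ) • (θ ^ (i : ℕ)) y))

/-- `CellHC[ρ, d]`: VERBATIM the local notation of `…LowPicardRMCells` («CELL-SPLIT»). Local notation only. -/
local notation3 (prettyPrint := false) "CellHC[" ρ ", " d "]" =>
  (∀ (X : SchemeOver ℂ), IsSmoothProjective 4 X → IsOfK3HilbertSquareType X →
    ∀ (φ : complexBetti X 2 ≃ₗ[ℂ] (K3HilbertIndex → ℂ)) (P : complexBetti X (2 * 4)) (z : K3HilbertIndex → ℂ),
      MarkedK3Sq[X, φ, P, z] → ¬ SpIso[X, φ] → Module.finrank ℂ ↥(algebraicClasses X 1) = ρ →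
        RMgen[X, φ, z, d] → HodgeConjectureFor 4 X)

/-- `KSHC[hX]`: the Kuga–Satake statement for the fourfold (`hX : IsSmoothProjective 4 X`) (`IsKSCorrespondenceAlgebraicHK 2`). Local notation only. -/
local notation3 (prettyPrint := false) "KSHC[" hX "]" => (IsKSCorrespondenceAlgebraicHK 2 hX)

variable {X : SchemeOver ℂ} {φ : complexBetti X 2 ≃ₗ[ℂ] (K3HilbertIndex → ℂ)} {P : complexBetti X (2 * 4)}
  {z : K3HilbertIndex → ℂ}

/-! ### §1 T1 core without Varesco's record -/

/-- **T1 core (cycle form), Varesco-free: `θ = [Z]_*` on `T(X)` for an algebraic class `Z ∈ A⁴(X × X)`**, for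
`θ` rational, type-preserving, `q`-self-adjoint, with `q`-transcendental image and `θ² = d ≠ 0` on `T(X)`, GRANTED
`IsKSCorrespondenceAlgebraicHK 2` for the marked `K3^{[2]}`-type `X` — this seat's
`KugaSatakeHK.exists_algebraicCorrespondence_eq_on_bbfTransc_of_kugaSatake'` normalised to the complex
orientations (`IsAlgebraicCorrespondence.exists_eq_corrAction`; degree `e = 4` forced). CONDITIONAL on Kuga–Satake
for `X`; fact CharlesMarkman2013 only. [cite: Varesco2023, Cor. 4.6] [cite: CharlesMarkman2013, Thm. 1.1 (§1)]
[cite: Andre1996Motifs, §2.1 (p. 14)] -/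
theorem exists_corrAction_eq_on_bbfTransc_of_kugaSatakeHK
    (hB : CharlesMarkman2013_lefschetzStandard_K3HilbertType)
    (hX : IsSmoothProjective 4 X) (hK : IsOfK3HilbertSquareType X) (hM : MarkedK3Sq[X, φ, P, z]) (hKS : KSHC[hX])
    (θ : complexBetti X 2 →ₗ[ℂ] complexBetti X 2)
    (h1 : ∀ y, IsRationalClass y → IsRationalClass (θ y))
    (h2 : ∀ (i j : ℕ) y, IsOfHodgeType 4 X 2 i j y → IsOfHodgeType 4 X 2 i j (θ y))
    (h4 : ∀ y : complexBetti X 2, ∀ d : complexBetti X 2, d ∈ algebraicClasses X 1 →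
      k3HilbertForm 2 (φ (θ y)) (φ d) = 0)
    (h5 : ∀ y w : complexBetti X 2, k3HilbertForm 2 (φ (θ y)) (φ w) = k3HilbertForm 2 (φ y) (φ (θ w)))
    (d : ℚ) (hd : d ≠ 0)
    (hθθ : ∀ y : complexBetti X 2,
      (∀ e : complexBetti X 2, e ∈ algebraicClasses X 1 → k3HilbertForm 2 (φ y) (φ e) = 0) →
      θ (θ y) = (d : ℂ) • y) :
    ∃ Z ∈ algebraicClasses (X ⊗ X) 4, ∀ y : complexBetti X 2,
      (∀ e : complexBetti X 2, e ∈ algebraicClasses X 1 → k3HilbertForm 2 (φ y) (φ e) = 0) →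
      corrAction complexOrientationFamily hX hX (rfl : 2 + 2 * 4 = 2 + 2 * 4) Z y = θ y := by
  obtain ⟨T, hTalg, hTθ⟩ := KugaSatakeHK.exists_algebraicCorrespondence_eq_on_bbfTransc_of_kugaSatake' hB hX hK hM
    hKS θ h1 h2 h4 h5 d hd hθθ
  obtain ⟨e, hab, γ, hγ, hT⟩ :=
    Summit.HodgeConjecture.HodgeConjecture.Ring2.AbelianAll.IsAlgebraicCorrespondence.exists_eq_corrAction hX hX hTalg
  obtain rfl : e = 4 := by omega
  refine ⟨γ, hγ, fun y hy => ?_⟩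
  rw [← hTθ y hy, hT]

/-! ### §2 «ORPH-KS» without Varesco's record -/

/-- **T1 «ORPH-KS», Varesco-free: `HodgeConjectureFor 4 X` for every marked smooth projective `K3^{[2]}`-type
fourfold whose transcendental Hodge endomorphisms are generated by a `q`-self-adjoint `θ` with `θ² = d ≠ 0` on
`T(X)`, GRANTED the Kuga–Satake statement `IsKSCorrespondenceAlgebraicHK 2` for `X`**, modulo the THREE records
{Verbitsky–Guan, O'Grady 2008, Charles–Markman 2013} (Varesco 2023 Cor. 4.6 is now PROVED for such `X` in
`…K3Sq2KugaSatakeSelfSimilitudeHK`; the Beauville record is no longer needed). Proof VERBATIM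
`OrphanKS.hodgeConjectureFor_of_quadraticEndomorphismField_of_kugaSatake` with the Varesco-free core. CONDITIONAL;
credits nothing to the Hodge conjecture. [cite: Varesco2023, Cor. 4.6 and Conj. 4.2]
[cite: CharlesMarkman2013, Thm. 1.1 (§1)] [cite: Markman2024, §1.1 Thm. 1.1] [cite: VoisinHodgeI2002, §11.3.3 Lemma 11.41] -/
theorem hodgeConjectureFor_of_quadraticEndomorphismField_of_kugaSatakeHK
    (hV : VerbitskyGuan_cohomology_K3HilbertSquareType) (hO : OGrady2008_dualBBFClass_algebraic)
    (hB : CharlesMarkman2013_lefschetzStandard_K3HilbertType)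
    (hX : IsSmoothProjective 4 X) (hK : IsOfK3HilbertSquareType X) (hM : MarkedK3Sq[X, φ, P, z]) (hKS : KSHC[hX])
    (θ : complexBetti X 2 →ₗ[ℂ] complexBetti X 2)
    (h1 : ∀ y, IsRationalClass y → IsRationalClass (θ y))
    (h2 : ∀ (i j : ℕ) y, IsOfHodgeType 4 X 2 i j y → IsOfHodgeType 4 X 2 i j (θ y))
    (h4 : ∀ y : complexBetti X 2, ∀ d : complexBetti X 2, d ∈ algebraicClasses X 1 →
      k3HilbertForm 2 (φ (θ y)) (φ d) = 0)
    (h5 : ∀ y w : complexBetti X 2, k3HilbertForm 2 (φ (θ y)) (φ w) = k3HilbertForm 2 (φ y) (φ (θ w)))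
    (d : ℚ) (hd : d ≠ 0)
    (hθθ : ∀ y : complexBetti X 2,
      (∀ e : complexBetti X 2, e ∈ algebraicClasses X 1 → k3HilbertForm 2 (φ y) (φ e) = 0) →
      θ (θ y) = (d : ℂ) • y)
    (hgen : ∀ f : complexBetti X 2 →ₗ[ℂ] complexBetti X 2, (∀ y, IsRationalClass y → IsRationalClass (f y)) →
      (∀ (i j : ℕ) y, IsOfHodgeType 4 X 2 i j y → IsOfHodgeType 4 X 2 i j (f y)) →
      (∀ e : complexBetti X 2, e ∈ algebraicClasses X 1 → f e = 0) →
      (∀ y : complexBetti X 2, ∀ e : complexBetti X 2, e ∈ algebraicClasses X 1 →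
        k3HilbertForm 2 (φ (f y)) (φ e) = 0) →
      ∃ a c : ℚ, ∀ y : complexBetti X 2,
        (∀ e : complexBetti X 2, e ∈ algebraicClasses X 1 → k3HilbertForm 2 (φ y) (φ e) = 0) →
        f y = (a : ℂ) • y + (c : ℂ) • θ y) :
    HodgeConjectureFor 4 X := by
  classical
  obtain ⟨Z, hZ, hZθ⟩ := exists_corrAction_eq_on_bbfTransc_of_kugaSatakeHK hB hX hK hM hKS θ h1 h2 h4 h5 d hd hθθ
  obtain ⟨Z', hZ', hZ'rat, hZ'θ⟩ := OrphanKS.exists_rational_corrAction_eq_on_bbfTransc hX hM θ h1 hZ hZθ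
  have hXX : IsSmoothProjective (4 + 4) (X ⊗ X) := hX.tensor_holds hX
  refine hodgeConjectureFor_of_cycleInducedGenerator_of_charlesMarkman hV hO hB hX hK hM
    (corrAction complexOrientationFamily hX hX (rfl : 2 + 2 * 4 = 2 + 2 * 4) Z') ?_ ?_ ⟨Z', hZ', fun y => rfl⟩ ?_
  · intro y hy
    exact isRationalClass_corrAction_complexOrientationFamily hX hX _ hZ'rat hy
  · intro a b y hy
    exact isOfHodgeType_corrAction_of_type_self complexOrientationFamily exists_isReal_hodgeModel_holds hX hX _
      (isOfHodgeType_of_mem_algebraicClasses_of_isSmoothProjective hXX 4 hZ') rfl rfl hy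
  · intro f hf1 hf2 hf3 hf4
    obtain ⟨a, c, hac⟩ := hgen f hf1 hf2 hf3 hf4
    refine ⟨2, ![a, c], fun y hy => ?_⟩
    rw [hac y hy, Fin.sum_univ_two]
    simp only [Matrix.cons_val_zero, Matrix.cons_val_one, Fin.val_zero, Fin.val_one, pow_zero, pow_one,
      Module.End.one_apply, hZ'θ y hy]

/-! ### §3 «CELL12-KS», Picard rank one and crux #5 without Varesco's record -/

/-- **`RMgen[X, φ, z, 2]` + Kuga–Satake for `X` ⇒ `HodgeConjectureFor 4 X`, Varesco-free** (proof VERBATIM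
`hodgeConjectureFor_of_rmGenerator_two_of_kugaSatake`, ending in the Varesco-free «ORPH-KS»). CONDITIONAL on the
Kuga–Satake statement for `X`; facts {Verbitsky–Guan, O'Grady 2008, Charles–Markman 2013}. Credits nothing to HC.
[cite: Varesco2023, Cor. 4.6 and Rem. 5.5] [cite: CharlesMarkman2013, Thm. 1.1 (§1)] [cite: Vangeemen2008, Lemma 3.2] -/
theorem hodgeConjectureFor_of_rmGenerator_two_of_kugaSatakeHK
    (hV : VerbitskyGuan_cohomology_K3HilbertSquareType) (hO : OGrady2008_dualBBFClass_algebraic)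
    (hB : CharlesMarkman2013_lefschetzStandard_K3HilbertType) (hX : IsSmoothProjective 4 X) (hK : IsOfK3HilbertSquareType X) (hM : MarkedK3Sq[X, φ, P, z])
    (hKS : KSHC[hX]) (hgen2 : RMgen[X, φ, z, 2]) : HodgeConjectureFor 4 X := by
  classical
  obtain ⟨-, -, -, ⟨hz20, -⟩, h11, -, hzpos⟩ := id hM
  obtain ⟨θ, h1, h2, h5, ev, hθσ, -, hdeg, -, hGEN⟩ := hgen2
  obtain ⟨πT, hπN, hπT, hπimg, hπsub, hπrat, hπsa, hπtyp⟩ := exists_transcendentalProjector hX hM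
  -- `σ = φ⁻¹ z` is transcendental and non-zero
  set σ := LinearEquiv.symm φ z with hσdef
  have hφσ : φ σ = z := by rw [hσdef, LinearEquiv.apply_symm_apply]
  have hσT : ∀ d : complexBetti X 2, d ∈ algebraicClasses X 1 → k3HilbertForm 2 (φ σ) (φ d) = 0 := by
    intro d hd
    rw [hφσ, k3HilbertForm_comm]
    exact ((h11 d).1 (isOfHodgeType_of_mem_algebraicClasses_of_isSmoothProjective hX 1 hd)).1
  have hσne : σ ≠ 0 := by
    intro h0
    have hz : z = 0 := by rw [← hφσ, h0, map_zero]
    rw [hz, k3HilbertForm_eq_dotProduct] at hzpos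
    simp at hzpos
  -- `θ` preserves `N¹(X)` and `T(X)`
  have hθN : ∀ d ∈ algebraicClasses X 1, θ d ∈ algebraicClasses X 1 := mapsTo_algebraicClasses_one_fourfold hX θ h1 h2
  have hθT : ∀ y : complexBetti X 2, (∀ d ∈ algebraicClasses X 1, k3HilbertForm 2 (φ y) (φ d) = 0) →
      ∀ d ∈ algebraicClasses X 1, k3HilbertForm 2 (φ (θ y)) (φ d) = 0 :=
    fun y hy d hd => by rw [h5, hy _ (hθN d hd)]
  -- GEN on `θ²`: `θ² = b + a θ` on `T(X)`
  obtain ⟨c, hc⟩ := hGEN (θ ∘ₗ θ) (fun y hy => h1 _ (h1 y hy)) (fun i j y hy => h2 i j _ (h2 i j y hy))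
  set a : ℚ := c 1 with ha
  set b : ℚ := c 0 with hb
  have hθθ : ∀ y : complexBetti X 2, (∀ d ∈ algebraicClasses X 1, k3HilbertForm 2 (φ y) (φ d) = 0) →
      θ (θ y) = (b : ℂ) • y + (a : ℂ) • θ y := by
    intro y hy
    have h := hc y hy
    rw [LinearMap.comp_apply, Fin.sum_univ_two, Fin.val_zero, Fin.val_one, pow_zero, pow_one,
      Module.End.one_apply] at h
    exact h
  -- the eigenvalue relation and `d' := a² + 4b ≠ 0`
  have hevrel : ev * ev = (a : ℂ) * ev + (b : ℂ) := by
    have h := hθθ σ hσT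
    rw [hθσ, LinearMap.map_smul, hθσ, smul_smul, smul_smul, ← add_smul] at h
    have h' := smul_left_injective ℂ hσne h
    -- h' : ev * ev = b + a * ev
    rw [h']; ring
  have hd : a * a + 4 * b ≠ 0 := by
    intro hd0
    have hsq : (2 * ev - (a : ℂ)) * (2 * ev - (a : ℂ)) = 0 := by
      have : ((a * a + 4 * b : ℚ) : ℂ) = 0 := by rw [hd0, Rat.cast_zero]
      rw [Rat.cast_add, Rat.cast_mul, Rat.cast_mul, Rat.cast_ofNat] at this
      linear_combination (4 : ℂ) * hevrel + this
    have hev : ev = ((a / 2 : ℚ) : ℂ) := by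
      rcases mul_self_eq_zero.1 hsq with h0
      rw [Rat.cast_div, Rat.cast_ofNat]
      linear_combination h0 / 2
    have h1' : (minpoly ℚ ev).natDegree = 1 := by
      rw [hev, show ((a / 2 : ℚ) : ℂ) = algebraMap ℚ ℂ (a / 2) from (eq_ratCast _ _).symm,
        minpoly.eq_X_sub_C (B := ℂ) (a / 2), Polynomial.natDegree_X_sub_C]
    omega
  -- `θ' := (2θ − a) ∘ π_T`
  let θ' : complexBetti X 2 →ₗ[ℂ] complexBetti X 2 :=
    ((2 : ℂ) • θ + ((-a : ℚ) : ℂ) • LinearMap.id) ∘ₗ πT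
  have hθ'app : ∀ y, θ' y = (2 : ℂ) • θ (πT y) + ((-a : ℚ) : ℂ) • πT y := fun y => by
    simp only [θ', LinearMap.comp_apply, LinearMap.add_apply, LinearMap.smul_apply, LinearMap.id_apply]
  have hθ'T : ∀ y : complexBetti X 2, (∀ d ∈ algebraicClasses X 1, k3HilbertForm 2 (φ y) (φ d) = 0) →
      θ' y = (2 : ℂ) • θ y - (a : ℂ) • y := by
    intro y hy
    rw [hθ'app, hπT y hy, Rat.cast_neg, neg_smul, sub_eq_add_neg]
  have h1' : ∀ y, IsRationalClass y → IsRationalClass (θ' y) := by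
    intro y hy
    rw [hθ'app, show (2 : ℂ) = ((2 : ℚ) : ℂ) by norm_num]
    exact ((h1 _ (hπrat y hy)).smul 2).add ((hπrat y hy).smul (-a))
  have h2' : ∀ (i j : ℕ) y, IsOfHodgeType 4 X 2 i j y → IsOfHodgeType 4 X 2 i j (θ' y) := by
    intro i j y hy
    rw [hθ'app]
    exact ((h2 i j _ (hπtyp i j y hy)).smul _).add hX ((hπtyp i j y hy).smul _)
  have h4' : ∀ y : complexBetti X 2, ∀ d : complexBetti X 2, d ∈ algebraicClasses X 1 →
      k3HilbertForm 2 (φ (θ' y)) (φ d) = 0 := by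
    intro y d hd
    rw [hθ'app, map_add, map_smul, map_smul, k3HilbertForm_add_left, k3HilbertForm_smul_left,
      k3HilbertForm_smul_left, hθT _ (hπimg y) d hd, hπimg y d hd, mul_zero, mul_zero, add_zero]
  -- `π_T` commutes with `θ`
  have hcomm : ∀ w : complexBetti X 2, πT (θ w) = θ (πT w) := by
    intro w
    have hn : w - πT w ∈ algebraicClasses X 1 := hπsub w
    have hsplit : θ w = θ (πT w) + θ (w - πT w) := by rw [← map_add, add_sub_cancel]
    rw [hsplit, map_add, hπN _ (hθN _ hn), add_zero, hπT _ (hθT _ (hπimg w))]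
  have h5' : ∀ y w : complexBetti X 2, k3HilbertForm 2 (φ (θ' y)) (φ w) = k3HilbertForm 2 (φ y) (φ (θ' w)) := by
    intro y w
    rw [hθ'app, hθ'app, map_add, map_smul, map_smul, map_add, map_smul, map_smul, k3HilbertForm_add_left,
      k3HilbertForm_smul_left, k3HilbertForm_smul_left, k3HilbertForm_add_right, k3HilbertForm_smul_right,
      k3HilbertForm_smul_right, h5, ← hcomm, hπsa, hπsa y]
  have hθ'θ' : ∀ y : complexBetti X 2,
      (∀ e : complexBetti X 2, e ∈ algebraicClasses X 1 → k3HilbertForm 2 (φ y) (φ e) = 0) →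
      θ' (θ' y) = ((a * a + 4 * b : ℚ) : ℂ) • y := by
    intro y hy
    have hyT' : ∀ e ∈ algebraicClasses X 1, k3HilbertForm 2 (φ (θ' y)) (φ e) = 0 := fun e he => h4' y e he
    rw [hθ'T _ hyT', hθ'T y hy, map_sub, LinearMap.map_smul, LinearMap.map_smul, hθθ y hy, Rat.cast_add,
      Rat.cast_mul, Rat.cast_mul, Rat.cast_ofNat]
    module
  have hgen' : ∀ f : complexBetti X 2 →ₗ[ℂ] complexBetti X 2, (∀ y, IsRationalClass y → IsRationalClass (f y)) →
      (∀ (i j : ℕ) y, IsOfHodgeType 4 X 2 i j y → IsOfHodgeType 4 X 2 i j (f y)) →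
      (∀ e : complexBetti X 2, e ∈ algebraicClasses X 1 → f e = 0) →
      (∀ y : complexBetti X 2, ∀ e : complexBetti X 2, e ∈ algebraicClasses X 1 →
        k3HilbertForm 2 (φ (f y)) (φ e) = 0) →
      ∃ a' c' : ℚ, ∀ y : complexBetti X 2,
        (∀ e : complexBetti X 2, e ∈ algebraicClasses X 1 → k3HilbertForm 2 (φ y) (φ e) = 0) →
        f y = (a' : ℂ) • y + (c' : ℂ) • θ' y := by
    intro f hf_rat hf_typ _ _
    obtain ⟨c', hc'⟩ := hGEN f hf_rat hf_typ
    refine ⟨c' 0 + c' 1 * a / 2, c' 1 / 2, fun y hy => ?_⟩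
    have h := hc' y hy
    rw [Fin.sum_univ_two, Fin.val_zero, Fin.val_one, pow_zero, pow_one, Module.End.one_apply] at h
    rw [h, hθ'T y hy, Rat.cast_add, Rat.cast_div, Rat.cast_mul, Rat.cast_div, Rat.cast_ofNat]
    module
  exact hodgeConjectureFor_of_quadraticEndomorphismField_of_kugaSatakeHK hV hO hB hX hK hM hKS θ' h1' h2' h4' h5'
    (a * a + 4 * b) hd hθ'θ' hgen'

/-- **«CELL12-KS», Varesco-free: the real-QUADRATIC cells `CellHC[ρ, 2]` hold for every `ρ`, GRANTED the Kuga–Satake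
statement on the fourfolds concerned.** CONDITIONAL; credits nothing to HC. [cite: Varesco2023, Cor. 4.6 and Conj. 4.2]
[cite: CharlesMarkman2013, Thm. 1.1 (§1)] -/
theorem cellHC_two_of_kugaSatakeHK
    (hV : VerbitskyGuan_cohomology_K3HilbertSquareType) (hO : OGrady2008_dualBBFClass_algebraic)
    (hB : CharlesMarkman2013_lefschetzStandard_K3HilbertType)
    (hKS : ∀ (Y : SchemeOver ℂ) (hY : IsSmoothProjective 4 Y), IsOfK3HilbertSquareType Y →
      ∀ (φ : complexBetti Y 2 ≃ₗ[ℂ] (K3HilbertIndex → ℂ)) (P : complexBetti Y (2 * 4)) (z : K3HilbertIndex → ℂ),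
        MarkedK3Sq[Y, φ, P, z] → ¬ SpIso[Y, φ] → RMgen[Y, φ, z, 2] → KSHC[hY])
    (ρ : ℕ) : CellHC[ρ, 2] :=
  fun Y hY hK φ P z hM hsp _ hgen2 =>
    hodgeConjectureFor_of_rmGenerator_two_of_kugaSatakeHK hV hO hB hY hK hM (hKS Y hY hK φ P z hM hsp hgen2) hgen2

/-- **Picard rank `1`, not isometry-spanned, Varesco-free: Kuga–Satake for `X` ⇒ `HodgeConjectureFor 4 X`** for
every marked projective `K3^{[2]}`-type fourfold (`rank T(X) = 22 = d·n`, `n ≥ 3` forces `d = 2`). CONDITIONAL on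
Kuga–Satake for `X`; facts {Verbitsky–Guan, O'Grady 2008, Charles–Markman 2013}.
[cite: Varesco2023, Cor. 4.6 and Conj. 4.2] [cite: Vangeemen2008, Lemma 3.2] -/
theorem hodgeConjectureFor_of_picard_one_of_kugaSatakeHK
    (hV : VerbitskyGuan_cohomology_K3HilbertSquareType) (hO : OGrady2008_dualBBFClass_algebraic)
    (hB : CharlesMarkman2013_lefschetzStandard_K3HilbertType)
    (hX : IsSmoothProjective 4 X) (hK : IsOfK3HilbertSquareType X) (hM : MarkedK3Sq[X, φ, P, z])
    (hsp : ¬ SpIso[X, φ]) (hρ : Module.finrank ℂ ↥(algebraicClasses X 1) = 1) (hKS : KSHC[hX]) :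
    HodgeConjectureFor 4 X := by
  obtain ⟨d, hd2, hgen⟩ := exists_rmGenerator_of_not_spannedByIsometries hX hM hsp
  obtain ⟨-, -, -, -, -, -, -, -, ⟨n, hn, hdn⟩, -⟩ := id hgen
  rcases cell_cases (by omega : Module.finrank ℂ ↥(algebraicClasses X 1) ≤ 3) hd2 hn hdn with
    ⟨-, rfl⟩ | ⟨hρ', -⟩ | ⟨hρ', -⟩
  · exact hodgeConjectureFor_of_rmGenerator_two_of_kugaSatakeHK hV hO hB hX hK hM hKS hgen
  · omega
  · omega

/-- **Crux #5 `LowPicardRealMultiplication` BY NAME, Varesco-free, from Kuga–Satake on the quadratic cells and HC⁴ on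
the four cells of degree `≥ 3`** (`(2,3)`, `(2,7)`, `(3,4)`, `(3,5)`): «CELL-SPLIT» with `cellHC_two_of_kugaSatakeHK` at
`ρ = 1` and `ρ = 3`. CONDITIONAL; credits nothing to HC; facts {Verbitsky–Guan, O'Grady 2008, Charles–Markman 2013}.
[cite: Varesco2023, Cor. 4.6 and Conj. 4.2] [cite: Vangeemen2008, Lemma 3.2] -/
theorem lowPicardRealMultiplication_of_kugaSatakeHK_of_four_cells
    (hV : VerbitskyGuan_cohomology_K3HilbertSquareType) (hO : OGrady2008_dualBBFClass_algebraic)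
    (hB : CharlesMarkman2013_lefschetzStandard_K3HilbertType)
    (hKS : ∀ (X : SchemeOver ℂ) (hX : IsSmoothProjective 4 X), IsOfK3HilbertSquareType X →
      ∀ (φ : complexBetti X 2 ≃ₗ[ℂ] (K3HilbertIndex → ℂ)) (P : complexBetti X (2 * 4)) (z : K3HilbertIndex → ℂ),
        MarkedK3Sq[X, φ, P, z] → ¬ SpIso[X, φ] → RMgen[X, φ, z, 2] → KSHC[hX])
    (h23 : CellHC[2, 3]) (h27 : CellHC[2, 7]) (h34 : CellHC[3, 4]) (h35 : CellHC[3, 5]) :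
    Summit.HodgeConjecture.HodgeConjecture.Theses.MarkmanPartnerTransport.LowPicardRealMultiplication :=
  lowPicardRealMultiplication_of_six_cells (cellHC_two_of_kugaSatakeHK hV hO hB hKS 1) h23 h27
    (cellHC_two_of_kugaSatakeHK hV hO hB hKS 3) h34 h35

end Summit.HodgeConjecture.HodgeConjecture.Theorems.MarkmanPartnerTransport.PartnerLattice

end
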